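import Summits.CriticalPhenomena.PercolationContinuityZ3.Theorems.Transplant.BccClawX2Table
import Summits.CriticalPhenomena.PercolationContinuityZ3.Theorems.Transplant.BccClawXSound
import HarnessLib

/-!
# The bcc (001)-slabs, exit-form routing certificate for THICKNESS `k = 2`, IV: SOUNDNESS of the parity-aware rule `clawX2` and its DIAGONAL MIRROR

builds on p205010 (kernel theorem, internal audit signed; external expert review pending) — NOT used in this file.
Lane `prim-bschramm`, seat `prim-bschramm-p2` (gen 47; class C1b, METHOD = input substitution; memo `HOME/bschramm/P2-LATTICES.md` §157); helper file
(`--supports stmt-CriticalPhenomena-4575 --as helper`).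
* §1 **`clawX2_sound`**: `clawX2 ε … = some (q, l₁, l₂, l₃)` gives an EVEN hub (`evenb ε q`) and a claw («BccClawXSound».`ClawProps`) — the `Prop` form the
  even-hub template «BccSlabTwoHub» consumes;
* §2 the diagonal mirror `sw` preserves the parity test, the twin test and the admissibility (`evenb_sw`, `twinOK_sw`, `admissible2_sw`), so the kernel
  theorems for the clip classes with `t_R = 3` («BccClawX2TableOK*») serve the classes with `t_R < 3` too («BccClawX2Legs»).
[cite: DuminilCopinSidoraviciusTassion2016, §2.3 (proof of Fact 2: the three disjoint paths in B̄_R(z))]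
-/

namespace Summit.CriticalPhenomena.PercolationContinuityZ3.Theorems.Transplant

namespace BccClawX

/-! ## §1 Soundness of the parity-aware rule -/

/-- **Soundness of the parity-aware rule**: an even hub and a claw. [folklore] -/
theorem clawX2_sound {ε : ℤ} {tR tD sR sD : ℕ} {a1 a2 a3 q : Pt} {l1 l2 l3 : List Pt} (h : clawX2 ε tR tD sR sD a1 a2 a3 = some (q, l1, l2, l3)) :
    evenb ε q = true ∧ ClawProps tR tD sR sD a1 a2 a3 q l1 l2 l3 := by
  unfold clawX2 at h
  obtain ⟨q', -, hq'⟩ := List.exists_of_findSome?_eq_some h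
  split_ifs at hq' with hcond
  simp only at hq'
  obtain ⟨m1, hm1, h1⟩ := List.exists_of_findSome?_eq_some hq'
  obtain ⟨m2, hm2, h2⟩ := List.exists_of_findSome?_eq_some h1
  rw [List.mem_filter] at hm1 hm2
  split_ifs at h2 with h12
  simp only [Option.map_eq_some_iff] at h2
  obtain ⟨m3, hm3, hx⟩ := h2
  have hp3 := List.find?_some hm3
  have hm3' := List.mem_of_find?_eq_some hm3
  rw [List.mem_filter] at hm3'
  simp only [Prod.mk.injEq] at hx
  obtain ⟨rfl, rfl, rfl, rfl⟩ := hx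
  simp only [Bool.or_eq_true, Bool.not_eq_true', beq_iff_eq, Bool.and_eq_true, decide_eq_true_eq, beq_eq_false_iff_ne, ne_eq,
    Bool.not_eq_false, not_or] at hcond hm1 hm2 hm3' hp3 h12
  obtain ⟨⟨⟨⟨hev, hcq⟩, hqa1⟩, hqa2⟩, hqa3⟩ := hcond
  have hsame : (a1 == a2) = true ↔ a1 = a2 := beq_iff_eq
  refine ⟨hev, by simpa using hcq, hqa1, hqa2, hqa3, ?_, ?_, legOK_sound hm3'.2, ?_, ?_, fun h => h12.1 h.symm, hp3.1.1.1, hp3.1.1.2, ?_, ?_, ?_⟩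
  · convert legOK_sound hm1.2.1 using 2
  · convert legOK_sound hm2.2.1 using 2
  · intro he
    have := hm1.2.2
    rcases this with h | h
    · exact absurd (hsame.2 he) (by simp [h])
    · exact h
  · intro he
    have := hm2.2.2
    rcases this with h | h
    · exact absurd (hsame.2 he) (by simp [h])
    · exact h
  · intro w hw hw2
    have := disjB_sound h12.2 w hw hw2
    exact ⟨hsame.1 this.1, this.2⟩
  · intro w hw hw1
    have := disjB_sound hp3.1.2 w hw hw1
    simp at this
  · intro w hw hw2
    have := disjB_sound hp3.2 w hw hw2
    simp at this

/-! ## §2 The diagonal mirror preserves parity, the twin test and admissibility -/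

/-- The parity test is mirror-invariant. [folklore] -/
theorem evenb_sw (ε : ℤ) (q : Pt) : evenb ε (sw q) = evenb ε q := by
  simp only [evenb, sw]; rw [add_comm q.2 q.1]

/-- `List.contains` along the mirror of the neighbour list. [folklore] -/
theorem nbrs_sw_contains (a c : Pt) : (nbrs (sw a)).contains (sw c) = (nbrs a).contains c := by
  have h1 : (nbrs (sw a)).contains (sw c) = true ↔ sw c ∈ nbrs (sw a) := List.contains_iff_mem
  have h2 : (nbrs a).contains c = true ↔ c ∈ nbrs a := List.contains_iff_mem
  have h3 : sw c ∈ nbrs (sw a) ↔ c ∈ nbrs a := by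
    rw [(nbrs_sw_perm a).mem_iff, List.mem_map]
    constructor
    · rintro ⟨x, hx, hxe⟩; rwa [← sw_injective hxe]
    · intro h; exact ⟨c, h, rfl⟩
  rw [Bool.eq_iff_iff, h1, h2, h3]

/-- The twin test is mirror-equivariant (cleared-block codes swapped). [folklore] -/
theorem twinOK_sw (ε : ℤ) (tD sD : ℕ) (a1 a3 : Pt) : twinOK ε tD sD (sw a1) (sw a3) = twinOK ε sD tD a1 a3 := by
  have hlen : ((nbrs (sw a1)).filter (isExt tD sD)).length = ((nbrs a1).filter (isExt sD tD)).length := by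
    rw [((nbrs_sw_perm a1).filter _).length_eq, List.filter_map, List.length_map]
    congr 2
    funext n
    simp only [Function.comp, isExt_sw]
  unfold twinOK
  rw [hlen, evenb_sw, nbrs_sw_contains]

/-- Admissibility at `k = 2` is mirror-equivariant. [folklore] -/
theorem admissible2_sw (ε : ℤ) (tD sD : ℕ) (a1 a2 a3 : Pt) :
    admissible2 ε tD sD (sw a1) (sw a2) (sw a3) = admissible2 ε sD tD a1 a2 a3 := by
  simp only [admissible2, twinOK_sw, sw_beq_sw]

end BccClawX

end Summit.CriticalPhenomena.PercolationContinuityZ3.Theorems.Transplant
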